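import Summits.QuantumFields.YangMills.Theorems.AllWindowsColdBoxGaussSideTerms
import Summits.QuantumFields.YangMills.Theorems.AllWindowsColdBoxTiltMoments
import Summits.QuantumFields.YangMills.Theorems.AllWindowsColdBoxBoxMidLineCoreBound
import Summits.QuantumFields.YangMills.Theorems.AllWindowsColdBoxTiltedCovSecondOrder
import Summits.QuantumFields.YangMills.Theorems.AllWindowsColdBoxGaussPolyHypercontractivity
import Summits.QuantumFields.YangMills.Theorems.AllWindowsColdBoxDirFreeVarLinear
import Summits.QuantumFields.YangMills.Theorems.AllWindowsColdBoxDirPoincareCubic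
import Summits.QuantumFields.YangMills.Theorems.AllWindowsColdBoxBoxMidOfDominationAbs
import HarnessLib

/-!
# Crux `AllWindowsColdBox.BoxMidWindowsSU22` (stmt-QuantumFields-24003) — the composition of LINE-17's seven landed stubs
# (CANDIDATE FILE prepared by width seat w2 g28 for the LEAD / crux holder; to be landed `--workitem stmt-QuantumFields-24003`)

LINE-17 «hypercontractive second-order tilt expansion» (planner ym-idea-2, skeleton v3 sha16 4747b363, critic-PASSed): all seven
registered stubs are in the tree by name — A `stub_tiltedCovSecondOrder` (…TiltedCovSecondOrder), B `stub_gaussPolyHypercontractivity`,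
C `stub_dirFreeVarLinear`, D `stub_dirPoincareCubic`, E `stub_tiltMoments` (✓p717894), F `stub_gaussSideTerms` (p720358),
G `stub_coreBound` (✓p710459).  This file is the registered composition, verbatim: `coreBound_holds` (G fed with A, E(B,C,D), F(C,D)),
the exponent bookkeeping `dominationMidAbs_of_coreBound` (`K⌈β^θ⌉⁶/β ≤ β^{−9θ}` eventually, `θ ≤ 1/16`), and the landed sandwich
`AllWindowsColdBox.boxMidWindowsSU22_of_dirichletDominationMidAbs`, giving **`BoxMidWindowsSU22_proof`** — the crux decl BY NAME.

No definition; standard axioms.  HONEST LABEL: closes ONE crux (rank R2ξ″, RECORD-label rung) of route AllWindowsColdBox when landed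
with `--workitem stmt-QuantumFields-24003` by its holder; no rung promotion or summit is claimed here; the Yang–Mills mass gap is NOT
proved by this file.
-/

set_option autoImplicit false

noncomputable section

open MeasureTheory ProbabilityTheory
open Literature.MathematicalPhysics.QuantumLattice
open Literature.MathematicalPhysics.QuantumFieldTheory
open Summit.QuantumFields.YangMills.Theorems.WeakCouplingRates
open Summit.QuantumFields.YangMills.Theorems.ColdBoxAllGroups
open Summit.QuantumFields.YangMills.Theorems.FreeEnergyLogCoefficient
open Summit.QuantumFields.YangMills.Theorems.AllWindowsColdBoxTiltedCov (TiltedCovSecondOrder stub_tiltedCovSecondOrder)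
open Summit.QuantumFields.YangMills.Theorems.AllWindowsColdBox.GaussHypercontractivity (GaussPolyHypercontractivity
  stub_gaussPolyHypercontractivity)
open Summit.QuantumFields.YangMills.Theorems.AllWindowsColdBoxDirFreeVar (DirFreeVarLinear stub_dirFreeVarLinear)
open Summit.QuantumFields.YangMills.Theorems.AllWindowsColdBox.DirPoincare (DirPoincareCubic stub_dirPoincareCubic)

namespace Summit.QuantumFields.YangMills.Theorems.AllWindowsColdBoxBoxMidLine

/-- **The core bound of LINE-17 holds** at every box exponent `0 < θ ≤ 1/16`: the registered stubs A, B, C, D, E, F, G of the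
line, all landed by name, composed exactly as in the registered skeleton (`BoxMidWindowsSU22_of`, sha16 4747b363). -/
theorem coreBound_holds (θ : ℝ) (hθ : 0 < θ) (hθ' : θ ≤ 1 / 16) : CoreBound θ :=
  stub_coreBound stub_tiltedCovSecondOrder θ hθ hθ'
    (stub_tiltMoments stub_gaussPolyHypercontractivity stub_dirFreeVarLinear stub_dirPoincareCubic θ hθ hθ')
    (stub_gaussSideTerms stub_dirFreeVarLinear stub_dirPoincareCubic θ hθ hθ')

/-- **Exponent bookkeeping** (verbatim from the registered skeleton v3): `CoreBound θ` with `0 < θ ≤ 1/16` gives the absolute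
Dirichlet comparison at rate `β^{−9θ}`: `K⌈β^θ⌉⁶/β ≤ 64K·β^{6θ−1} ≤ β^{1−15θ}·β^{6θ−1} = β^{−9θ}` once `β^{1−15θ} ≥ 64K`. -/
theorem dominationMidAbs_of_coreBound (θ : ℝ) (hθ : 0 < θ) (hθ' : θ ≤ 1 / 16) (h : CoreBound θ) :
    ∃ β₁ : ℝ, ∀ β : ℝ, β₁ ≤ β → ∀ T : ℕ, T ≤ ⌈β ^ θ⌉₊ →
      |β ^ 2 * boxPlaqCov ρ₂ β ⌈β ^ θ⌉₊ T - 3 / 4 * boxDirCircSqCov ⌈β ^ θ⌉₊ T| ≤ β ^ (-(9 * θ)) := by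
  obtain ⟨K, β₀, hK, hcore⟩ := h
  have h15 : 0 < 1 - 15 * θ := by linarith
  obtain ⟨β₂, hβ₂⟩ := Filter.eventually_atTop.1 (Filter.tendsto_atTop.1 (tendsto_rpow_atTop h15) (64 * K))
  refine ⟨max (max β₀ β₂) 1, fun β hβ T hT => ?_⟩
  have hβ0 : β₀ ≤ β := le_trans (le_trans (le_max_left _ _) (le_max_left _ _)) hβ
  have hβ2 : β₂ ≤ β := le_trans (le_trans (le_max_right _ _) (le_max_left _ _)) hβ
  have hβ1 : 1 ≤ β := le_trans (le_max_right _ _) hβ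
  have hβpos : 0 < β := lt_of_lt_of_le one_pos hβ1
  have hKβ : 64 * K ≤ β ^ (1 - 15 * θ) := hβ₂ β hβ2
  refine le_trans (hcore β hβ0 T hT) ?_
  have hθpow : 1 ≤ β ^ θ := Real.one_le_rpow hβ1 hθ.le
  have hceil : (⌈β ^ θ⌉₊ : ℝ) ≤ 2 * β ^ θ := by
    have := (Nat.ceil_lt_add_one (le_trans zero_le_one hθpow)).le
    linarith
  have hceil0 : 0 ≤ (⌈β ^ θ⌉₊ : ℝ) := Nat.cast_nonneg _
  have hpow6 : (⌈β ^ θ⌉₊ : ℝ) ^ 6 ≤ (2 * β ^ θ) ^ 6 := pow_le_pow_left₀ hceil0 hceil 6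
  have h26 : (2 * β ^ θ) ^ 6 = 64 * β ^ (6 * θ) := by
    rw [mul_pow]
    have : (β ^ θ) ^ (6 : ℕ) = β ^ (6 * θ) := by
      rw [← Real.rpow_natCast, ← Real.rpow_mul hβpos.le]
      norm_num [mul_comm]
    rw [this]; norm_num
  have step1 : K * (⌈β ^ θ⌉₊ : ℝ) ^ 6 / β ≤ K * (64 * β ^ (6 * θ)) / β := by
    have := mul_le_mul_of_nonneg_left (h26 ▸ hpow6) hK
    exact div_le_div_of_nonneg_right this hβpos.le
  have step2 : K * (64 * β ^ (6 * θ)) / β = 64 * K * β ^ (6 * θ - 1) := by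
    rw [Real.rpow_sub_one hβpos.ne']
    ring
  have step3 : 64 * K * β ^ (6 * θ - 1) ≤ β ^ (1 - 15 * θ) * β ^ (6 * θ - 1) :=
    mul_le_mul_of_nonneg_right hKβ (Real.rpow_nonneg hβpos.le _)
  have step4 : β ^ (1 - 15 * θ) * β ^ (6 * θ - 1) = β ^ (-(9 * θ)) := by
    rw [← Real.rpow_add hβpos]
    ring_nf
  calc K * (⌈β ^ θ⌉₊ : ℝ) ^ 6 / β ≤ K * (64 * β ^ (6 * θ)) / β := step1
    _ = 64 * K * β ^ (6 * θ - 1) := step2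
    _ ≤ β ^ (1 - 15 * θ) * β ^ (6 * θ - 1) := step3
    _ = β ^ (-(9 * θ)) := step4

/-- **The crux `AllWindowsColdBox.BoxMidWindowsSU22` (stmt-QuantumFields-24003), by name**, from the seven landed stubs of LINE-17
through the registered composition: `coreBound_holds` → `dominationMidAbs_of_coreBound` → the landed sandwich
`AllWindowsColdBox.boxMidWindowsSU22_of_dirichletDominationMidAbs`. -/
theorem BoxMidWindowsSU22_proof : Summit.QuantumFields.YangMills.Theses.AllWindowsColdBox.BoxMidWindowsSU22 :=
  Summit.QuantumFields.YangMills.Theorems.AllWindowsColdBox.boxMidWindowsSU22_of_dirichletDominationMidAbs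
    fun θ hθ hθ' => dominationMidAbs_of_coreBound θ hθ hθ' (coreBound_holds θ hθ hθ')

end Summit.QuantumFields.YangMills.Theorems.AllWindowsColdBoxBoxMidLine

end
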